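import Mathlib
import HarnessLib
import Summits.ValiantsHypothesis.ValiantsHypothesis.Theses.MonotoneRestoration
import Literature.Computability.AlgebraicComplexity.ArithCircuit
import Literature.Computability.AlgebraicComplexity.ArithCircuitProofs
import Literature.Computability.AlgebraicComplexity.MonotoneStructure
import Literature.Computability.AlgebraicComplexity.PermanentIrreducible
import Literature.ModelTheory.FiniteModelTheory.CkEquiv
import Summits.ValiantsHypothesis.ValiantsHypothesis.Theorems.MonotoneRestorationMonotoneRestorationQPCosetCount
import Summits.ValiantsHypothesis.ValiantsHypothesis.Theorems.MonotoneRestorationMonotoneRestorationQPSymmetricLB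
import Summits.ValiantsHypothesis.ValiantsHypothesis.Theorems.MonotoneRestorationMonotoneRestorationQPSupportSymmetrisation
import Summits.ValiantsHypothesis.ValiantsHypothesis.Theorems.MonotoneRestorationMonotoneRestorationQPSparseRegime
import Summits.ValiantsHypothesis.ValiantsHypothesis.Theorems.MonotoneRestorationMonotoneRestorationQPBeta
import Literature.Computability.AlgebraicComplexity.SymmetricArithCircuit
import Literature.Computability.AlgebraicComplexity.DawarWilsenach2025Proofs
import Literature.GroupTheory.PermutationGroups.SmallIndexSubgroups
import Summits.ValiantsHypothesis.ValiantsHypothesis.Theorems.MonotoneRestorationQP.Negative.LoadBearing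
import Summits.ValiantsHypothesis.ValiantsHypothesis.Theorems.MonotoneRestorationMonotoneRestorationQPPermSupportCount

/-! TTRL-lite variant V18933 of stmt-ValiantsHypothesis-15886 -/

-- `Summit.ValiantsHypothesis.ValiantsHypothesis.…` is the tree's mandated single-conjunct layout
-- (Sub = Summit), so the duplicated namespace component is intended.
set_option linter.dupNamespace false

namespace Summit.ValiantsHypothesis.ValiantsHypothesis.Theorems

open Summit.ValiantsHypothesis.ValiantsHypothesis.Theses.MonotoneRestoration
open Literature.Computability.AlgebraicComplexity

/-- **TTRL-lite variant V18933** (`drop_hyp`: part (2) of `stub_mulGate_children_extend` with the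
distinctness hypothesis `h ≠ h'` removed, i.e. two monomials `m, m'` taken from the SAME factor `p`
of a nonzero product `p * q` over `ℝ≥0`) is FALSE.  Witness (one variable `v = (0,0)`):
`p = X v`, `q = 1`, `f = X v`; the hypothesis holds with the shift `μ = 0` (`p * q = f`), and
`m = m' = v ∈ p.support`, but `m + m' + μ = 2v + μ` has `v`-degree `≥ 2` while the unique monomial
of `f` has `v`-degree `1`.  So the distinctness of the two children is load-bearing in part (2) of
the stub (item `stmt-ValiantsHypothesis-15886`). [folklore] -/
theorem stub_mulGate_children_extend_var18933_false :
    ¬ (∀ (p q f : MvPolynomial (Fin 1 × Fin 1) NNReal), p * q ≠ 0 →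
        (∃ μ : (Fin 1 × Fin 1) →₀ ℕ, ∀ m ∈ (p * q).support, m + μ ∈ f.support) →
        ∀ m ∈ p.support, ∀ m' ∈ p.support,
          ∃ μ : (Fin 1 × Fin 1) →₀ ℕ, m + m' + μ ∈ f.support) := by
  intro h
  suffices key : ∀ v : Fin 1 × Fin 1, False from key (0, 0)
  intro v
  -- the support of the witness `p = f = X v` is the single monomial `v`
  have hsupp : (MvPolynomial.X v : MvPolynomial (Fin 1 × Fin 1) NNReal).support =
      {Finsupp.single v 1} := MvPolynomial.support_X
  have hne : (MvPolynomial.X v * 1 : MvPolynomial (Fin 1 × Fin 1) NNReal) ≠ 0 := by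
    rw [mul_one]
    exact MvPolynomial.X_ne_zero v
  have hv : Finsupp.single v 1 ∈ (MvPolynomial.X v : MvPolynomial (Fin 1 × Fin 1) NNReal).support := by
    rw [hsupp]
    exact Finset.mem_singleton_self _
  -- instantiate the claimed implication at the witness (hypothesis holds with `μ = 0`)
  obtain ⟨μ, hμ⟩ := h (MvPolynomial.X v) 1 (MvPolynomial.X v) hne
    ⟨0, fun m hm => by rw [add_zero]; rwa [mul_one] at hm⟩
    (Finsupp.single v 1) hv (Finsupp.single v 1) hv
  rw [hsupp, Finset.mem_singleton] at hμ
  have h2 := DFunLike.congr_fun hμ v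
  simp only [Finsupp.add_apply, Finsupp.single_eq_same] at h2
  omega

end Summit.ValiantsHypothesis.ValiantsHypothesis.Theorems
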